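import Summits.Parity.BatemanHorn.Theorems.AlmostPrimeZerosSystemLSDRealSegmentReductionCore
import Summits.Parity.BatemanHorn.Theorems.AlmostPrimeZerosSystemLSDRealSegmentNairEuler
import Literature.NumberTheory.LFunctions.PolynomialRootMertensFirst
import HarnessLib

/-!
# `SystemLSDRealSegment` (stmt-Parity-11292), line `beta-thinned-root-kernel`: the twisted finite Euler product
# of the Type-I coefficient (lead c9, companion to the smooth-kernel localisation)

For a Bateman–Horn system `f`, real `y ≥ 1`, the Type-I coefficient `b = bCoeff f y` and the real local factors
`E_p(y) = Σ_{ν ≤ 2k} b(p^ν)`: with the Rankin exponent `δ = 2/log S`,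
`∏_{p < S} Σ_{ν ≤ 2k} b(p^ν) (p^ν)^δ ≤ e^B ∏_{p < S} E_p(y)` for all `S ≥ 2`, `B` independent of `S`
(`twistedLocalProduct_le`).  Ingredients: `E_p(y) ≥ 1` (`one_le_localSum`); `(p^ν)^δ ≤ e^{4k}` for `p < S`,
`ν ≤ 2k`; `p^δ − 1 ≤ 2e² log p / log S`; `b(p) = (y−1)Σᵢρᵢ(p)/p` and Landau's Mertens theorem for the roots of every
member; `b(p^ν) ≤ C/p²` (`ν ≥ 2`) beyond the `LocalCounts` threshold (`stub_typeILocal`).  This is the Rankin tail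
factor of the `y`-tilted Kubilius model at height `S` (file `…TruncatedLaw`).  Everything is PROVED; no definitions.
-/

open Filter Finset Polynomial
open scoped BigOperators Topology

namespace Summit.Parity.BatemanHorn.Cruxes.SystemLSDRealSegment.BetaThinnedRootKernel

open Literature.NumberTheory.Sieve

noncomputable section

variable {k : ℕ} {f : Fin k → ℤ[X]}

/-! ### `E_p(y) ≥ 1` -/

/-- **`E_p(y) ≥ 1` for real `y ≥ 1`**: `Σ_{ν ≤ 2k} b(p^ν) = E_p(y) = p⁻² Σ_{n mod p²} y^{s_{f,p}(n)} ≥ 1`. [folklore] -/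
theorem one_le_localSum (hf : IsBatemanHornSystem f) {y : ℝ} (hy : 1 ≤ y) {p : ℕ} (hp : p.Prime) :
    1 ≤ ∑ ν ∈ range (2 * k + 1), bCoeff f y (p ^ ν) := by
  have hE := (stub_typeILocal stub_congruenceFacts.2 k f hf y hy).2.2.2.2.2.2 p hp
  have hp0 : (0 : ℝ) < p := by exact_mod_cast hp.pos
  have h1 : localFactor f p (y : ℂ) =
      ((((p : ℝ) ^ 2)⁻¹ * ∑ n ∈ range (p ^ 2), y ^ (∑ i, localExp p ((f i).eval (n : ℤ))) : ℝ) : ℂ) := by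
    unfold localFactor; push_cast; rfl
  rw [h1] at hE
  have hE' := Complex.ofReal_injective hE
  rw [← hE']
  have hsum : ((p : ℝ) ^ 2) ≤ ∑ n ∈ range (p ^ 2), y ^ (∑ i, localExp p ((f i).eval (n : ℤ))) := by
    calc ((p : ℝ) ^ 2) = ∑ _n ∈ range (p ^ 2), (1 : ℝ) := by simp
      _ ≤ _ := Finset.sum_le_sum fun n _ => one_le_pow₀ hy
  rw [le_inv_mul_iff₀ (by positivity)]
  simpa using hsum

/-! ### Elementary exponent bounds -/

/-- For `2 ≤ p`, `p < S` (so `S ≥ 2`), `ν ≤ 2k`: `((p^ν : ℕ) : ℝ)^{2/log S} ≤ e^{4k}`. [folklore] -/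
theorem natPow_rpow_le_exp {p S ν k : ℕ} (hp : 2 ≤ p) (hpS : p < S) (hν : ν ≤ 2 * k) :
    ((p ^ ν : ℕ) : ℝ) ^ (2 / Real.log S) ≤ Real.exp (4 * k) := by
  have hp1 : (1 : ℝ) < p := by exact_mod_cast hp
  have hp0 : (0 : ℝ) < p := by linarith
  have hS1 : (1 : ℝ) < S := by exact_mod_cast lt_of_le_of_lt (show 1 ≤ p by omega) hpS
  have hlogS : 0 < Real.log S := Real.log_pos hS1
  have hlogp : Real.log p ≤ Real.log S := Real.log_le_log hp0 (by exact_mod_cast hpS.le)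
  have hlogp0 : 0 ≤ Real.log p := (Real.log_pos hp1).le
  push_cast
  rw [← Real.rpow_natCast, ← Real.rpow_mul hp0.le, Real.rpow_def_of_pos hp0, Real.exp_le_exp]
  have hν' : (ν : ℝ) ≤ 2 * k := by exact_mod_cast hν
  calc Real.log p * ((ν : ℝ) * (2 / Real.log S)) = (2 * ν) * (Real.log p / Real.log S) := by ring
    _ ≤ (2 * (2 * k)) * 1 := by
        refine mul_le_mul (by linarith) ((div_le_one hlogS).2 hlogp) (by positivity) (by positivity)
    _ = 4 * k := by ring

/-- For `2 ≤ p < S`: `p^{2/log S} − 1 ≤ 2e² log p / log S`. [folklore] -/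
theorem rpow_sub_one_le {p S : ℕ} (hp : 2 ≤ p) (hpS : p < S) :
    (p : ℝ) ^ (2 / Real.log S) - 1 ≤ 2 * Real.exp 2 * Real.log p / Real.log S := by
  have hp1 : (1 : ℝ) < p := by exact_mod_cast hp
  have hp0 : (0 : ℝ) < p := by linarith
  have hS1 : (1 : ℝ) < S := by exact_mod_cast lt_of_le_of_lt (show 1 ≤ p by omega) hpS
  have hlogS : 0 < Real.log S := Real.log_pos hS1
  have hlogp : Real.log p ≤ Real.log S := Real.log_le_log hp0 (by exact_mod_cast hpS.le)
  have hlogp0 : 0 ≤ Real.log p := (Real.log_pos hp1).le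
  set t : ℝ := Real.log p * (2 / Real.log S) with ht
  have ht0 : 0 ≤ t := by positivity
  have ht2 : t ≤ 2 := by
    rw [ht]
    calc Real.log p * (2 / Real.log S) = 2 * (Real.log p / Real.log S) := by ring
      _ ≤ 2 * 1 := by gcongr; exact (div_le_one hlogS).2 hlogp
      _ = 2 := by ring
  -- `e^t − 1 ≤ t e^t` (from `1 − t ≤ e^{−t}`; also in the tree as `…AreaLaw.exp_sub_one_le_mul_exp`)
  have hexp : Real.exp t - 1 ≤ t * Real.exp t := by
    have h := Real.add_one_le_exp (-t)
    have hpos := Real.exp_pos t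
    have : Real.exp (-t) * Real.exp t = 1 := by rw [← Real.exp_add]; simp
    nlinarith [mul_le_mul_of_nonneg_right h hpos.le]
  rw [Real.rpow_def_of_pos hp0]
  calc Real.exp (Real.log p * (2 / Real.log S)) - 1 = Real.exp t - 1 := by rw [ht]
    _ ≤ t * Real.exp t := hexp
    _ ≤ t * Real.exp 2 := by gcongr
    _ = 2 * Real.exp 2 * Real.log p / Real.log S := by rw [ht]; ring

/-! ### Mertens' first theorem for the members, from above -/

/-- **Landau–Mertens along the members, from above**: for a Bateman–Horn system there is `L` with
`Σ_{p ≤ Q} (Σᵢ ρᵢ(p)) log p / p ≤ k log Q + L` for all `Q ≥ 2`. [folklore] -/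
theorem exists_sum_rootCount_members_log_div_le (hf : IsBatemanHornSystem f) :
    ∃ L : ℝ, ∀ Q : ℕ, 2 ≤ Q →
      ∑ p ∈ Nat.primesLE Q, (∑ i, (polyRootCountMod ![f i] p : ℝ)) * Real.log p / p ≤ k * Real.log Q + L := by
  have h : ∀ i : Fin k, ∃ C : ℝ, ∀ Q : ℕ, 2 ≤ Q →
      |(∑ p ∈ Nat.primesLE Q, (polyRootCountMod ![f i] p : ℝ) * Real.log p / p) - Real.log Q| ≤ C :=
    fun i => Literature.NumberTheory.LFunctions.DegreeOnePrimes.abs_sum_primesLE_rootCount_mul_log_div_sub_log_le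
      (f i) (hf.irreducible i) (hf.natDegree_pos i)
  choose C hC using h
  refine ⟨∑ i, C i, fun Q hQ => ?_⟩
  have hterm : ∀ i, ∑ p ∈ Nat.primesLE Q, (polyRootCountMod ![f i] p : ℝ) * Real.log p / p ≤ Real.log Q + C i :=
    fun i => by
      have := (abs_le.1 (hC i Q hQ)).2
      linarith
  calc ∑ p ∈ Nat.primesLE Q, (∑ i, (polyRootCountMod ![f i] p : ℝ)) * Real.log p / p
      = ∑ i, ∑ p ∈ Nat.primesLE Q, (polyRootCountMod ![f i] p : ℝ) * Real.log p / p := by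
        rw [Finset.sum_comm]
        refine Finset.sum_congr rfl fun p _ => ?_
        rw [Finset.sum_mul, Finset.sum_div]
    _ ≤ ∑ i : Fin k, (Real.log Q + C i) := Finset.sum_le_sum fun i _ => hterm i
    _ = k * Real.log Q + ∑ i, C i := by
        rw [Finset.sum_add_distrib, Finset.sum_const, Finset.card_univ, Fintype.card_fin, nsmul_eq_mul]

/-! ### The twisted finite Euler product -/

/-- **The twisted finite Euler product of `b`**: for a Bateman–Horn system `f` and real `y ≥ 1` there is `B` such
that for every `S ≥ 2`, with `δ = 2/log S`,
`∏_{p < S} Σ_{ν ≤ 2k} b(p^ν) (p^ν)^δ ≤ e^B · ∏_{p < S} Σ_{ν ≤ 2k} b(p^ν)`. [folklore] -/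
theorem twistedLocalProduct_le (hf : IsBatemanHornSystem f) {y : ℝ} (hy : 1 ≤ y) :
    ∃ B : ℝ, ∀ S : ℕ, 2 ≤ S →
      ∏ p ∈ Nat.primesBelow S, ∑ ν ∈ range (2 * k + 1), bCoeff f y (p ^ ν) * ((p ^ ν : ℕ) : ℝ) ^ (2 / Real.log S) ≤
        Real.exp B * ∏ p ∈ Nat.primesBelow S, ∑ ν ∈ range (2 * k + 1), bCoeff f y (p ^ ν) := by
  obtain ⟨hb0, hb1, -, hbp, -, ⟨P₀, C, hC⟩, -⟩ := stub_typeILocal stub_congruenceFacts.2 k f hf y hy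
  obtain ⟨L, hL⟩ := exists_sum_rootCount_members_log_div_le hf
  set C' : ℝ := max C 0 with hC'
  have hC'0 : 0 ≤ C' := le_max_right _ _
  have hy1 : 0 ≤ y - 1 := by linarith
  -- the constant
  set B : ℝ := 4 * k * (P₀ + 1) + (2 * Real.exp 2 * (y - 1) * (k + |L| / Real.log 2) + 2 * k * C' * Real.exp (4 * k))
    with hBdef
  refine ⟨B, fun S hS => ?_⟩
  have hS1 : (1 : ℝ) < S := by exact_mod_cast hS
  have hlogS : 0 < Real.log S := Real.log_pos hS1
  have hlog2 : 0 < Real.log 2 := Real.log_pos (by norm_num)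
  have hlog2S : Real.log 2 ≤ Real.log S := Real.log_le_log (by norm_num) (by exact_mod_cast hS)
  set δ : ℝ := 2 / Real.log S with hδ
  -- notation for the local sums
  set E : ℕ → ℝ := fun p => ∑ ν ∈ range (2 * k + 1), bCoeff f y (p ^ ν) with hEdef
  set T : ℕ → ℝ := fun p => ∑ ν ∈ range (2 * k + 1), bCoeff f y (p ^ ν) * ((p ^ ν : ℕ) : ℝ) ^ δ with hTdef
  -- the per-prime excess for `p > P₀`
  set u : ℕ → ℝ := fun p => (y - 1) * (∑ i, (polyRootCountMod ![f i] p : ℝ)) / p *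
      (2 * Real.exp 2 * Real.log p / Real.log S) + 2 * k * C' * Real.exp (4 * k) / (p : ℝ) ^ 2 with hudef
  have hu0 : ∀ p : ℕ, 0 ≤ u p := fun p => by
    simp only [hudef]
    have : 0 ≤ Real.log (p : ℝ) := Real.log_natCast_nonneg p
    positivity
  -- the per-prime factor
  set c : ℕ → ℝ := fun p => if p ≤ P₀ then Real.exp (4 * k) else Real.exp (u p) with hcdef
  have hmem : ∀ p ∈ Nat.primesBelow S, p.Prime ∧ p < S := fun p hp => by
    have := Nat.mem_primesBelow.1 hp
    exact ⟨this.2, this.1⟩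
  -- (1) termwise: `T p ≤ c p * E p`
  have hT_le : ∀ p ∈ Nat.primesBelow S, T p ≤ c p * E p := by
    intro p hp
    obtain ⟨hpp, hpS⟩ := hmem p hp
    have hp2 : 2 ≤ p := hpp.two_le
    have hp0 : (0 : ℝ) < p := by exact_mod_cast hpp.pos
    have hE1 : 1 ≤ E p := one_le_localSum hf hy hpp
    -- crude bound, valid for every prime: `T p ≤ e^{4k} E p`
    have hcrude : T p ≤ Real.exp (4 * k) * E p := by
      simp only [hTdef, hEdef, Finset.mul_sum]
      refine Finset.sum_le_sum fun ν hν => ?_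
      rw [Finset.mem_range] at hν
      rw [mul_comm (Real.exp _)]
      exact mul_le_mul_of_nonneg_left (natPow_rpow_le_exp hp2 hpS (by omega)) (hb0 _)
    by_cases hsmall : p ≤ P₀
    · simp only [hcdef, if_pos hsmall]; exact hcrude
    · simp only [hcdef, if_neg hsmall]
      have hpP : P₀ < p := lt_of_not_ge hsmall
      -- `T p = E p + Σ_ν b(p^ν)((p^ν)^δ − 1)` and the excess is `≤ u p`
      have hsplit : T p = E p + ∑ ν ∈ range (2 * k + 1), bCoeff f y (p ^ ν) * (((p ^ ν : ℕ) : ℝ) ^ δ - 1) := by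
        simp only [hTdef, hEdef, ← Finset.sum_add_distrib]
        refine Finset.sum_congr rfl fun ν _ => by ring
      have hexcess : ∑ ν ∈ range (2 * k + 1), bCoeff f y (p ^ ν) * (((p ^ ν : ℕ) : ℝ) ^ δ - 1) ≤ u p := by
        -- split off `ν = 0` and `ν = 1`
        have hterm : ∀ ν ∈ range (2 * k + 1), bCoeff f y (p ^ ν) * (((p ^ ν : ℕ) : ℝ) ^ δ - 1) ≤
            (if ν = 1 then (y - 1) * (∑ i, (polyRootCountMod ![f i] p : ℝ)) / p *
              (2 * Real.exp 2 * Real.log p / Real.log S) else 0) +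
            (if 2 ≤ ν then C' * Real.exp (4 * k) / (p : ℝ) ^ 2 else 0) := by
          intro ν hν
          rw [Finset.mem_range] at hν
          rcases Nat.lt_or_ge ν 2 with hν2 | hν2
          · interval_cases ν
            · simp [hb1]
            · simp only [if_true, show ¬ (2 ≤ 1) from by omega, if_false, add_zero]
              rw [pow_one, hbp p hpp]
              have h1 : (p : ℝ) ^ δ - 1 ≤ 2 * Real.exp 2 * Real.log p / Real.log S := rpow_sub_one_le hp2 hpS
              have h2 : 0 ≤ (y - 1) * ∑ i, (polyRootCountMod ![f i] p : ℝ) / p := by positivity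
              calc (y - 1) * (∑ i, (polyRootCountMod ![f i] p : ℝ) / p) * ((p : ℝ) ^ δ - 1)
                  ≤ (y - 1) * (∑ i, (polyRootCountMod ![f i] p : ℝ) / p) *
                      (2 * Real.exp 2 * Real.log p / Real.log S) := mul_le_mul_of_nonneg_left h1 h2
                _ = (y - 1) * (∑ i, (polyRootCountMod ![f i] p : ℝ)) / p *
                      (2 * Real.exp 2 * Real.log p / Real.log S) := by rw [← Finset.sum_div]; ring
          · simp only [show ν ≠ 1 from by omega, if_false, zero_add, if_pos hν2]
            have hbν : bCoeff f y (p ^ ν) ≤ C' / (p : ℝ) ^ 2 :=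
              (hC p hpp hpP ν hν2).trans (div_le_div_of_nonneg_right (le_max_left _ _) (by positivity))
            have hpow : ((p ^ ν : ℕ) : ℝ) ^ δ - 1 ≤ Real.exp (4 * k) := by
              linarith [natPow_rpow_le_exp (k := k) hp2 hpS (show ν ≤ 2 * k by omega)]
            have hpow0 : 0 ≤ ((p ^ ν : ℕ) : ℝ) ^ δ - 1 := by
              rw [sub_nonneg]
              refine Real.one_le_rpow ?_ (by positivity)
              exact_mod_cast Nat.one_le_pow _ _ hpp.pos
            calc bCoeff f y (p ^ ν) * (((p ^ ν : ℕ) : ℝ) ^ δ - 1) ≤ C' / (p : ℝ) ^ 2 * Real.exp (4 * k) :=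
                  mul_le_mul hbν hpow hpow0 (by positivity)
              _ = C' * Real.exp (4 * k) / (p : ℝ) ^ 2 := by ring
        refine (Finset.sum_le_sum hterm).trans ?_
        rw [Finset.sum_add_distrib, Finset.sum_ite_eq' (range (2 * k + 1)) 1, ← Finset.sum_filter]
        have hcard : #((range (2 * k + 1)).filter fun ν => 2 ≤ ν) ≤ 2 * k := by
          have : (range (2 * k + 1)).filter (fun ν => 2 ≤ ν) ⊆ Finset.Icc 2 (2 * k) := by
            intro ν hν
            simp only [Finset.mem_filter, Finset.mem_range] at hν
            simp only [Finset.mem_Icc]; omega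
          exact (Finset.card_le_card this).trans (by simp)
        rw [Finset.sum_const, nsmul_eq_mul]
        simp only [hudef]
        have h3 : (#((range (2 * k + 1)).filter fun ν => 2 ≤ ν) : ℝ) * (C' * Real.exp (4 * k) / (p : ℝ) ^ 2) ≤
            2 * k * C' * Real.exp (4 * k) / (p : ℝ) ^ 2 := by
          have : (#((range (2 * k + 1)).filter fun ν => 2 ≤ ν) : ℝ) ≤ 2 * k := by exact_mod_cast hcard
          calc (#((range (2 * k + 1)).filter fun ν => 2 ≤ ν) : ℝ) * (C' * Real.exp (4 * k) / (p : ℝ) ^ 2)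
              ≤ (2 * k) * (C' * Real.exp (4 * k) / (p : ℝ) ^ 2) := mul_le_mul_of_nonneg_right this (by positivity)
            _ = _ := by ring
        split_ifs with h1
        · linarith
        · -- `1 ∉ range (2k+1)` forces `k = 0`
          have : 0 ≤ (y - 1) * (∑ i, (polyRootCountMod ![f i] p : ℝ)) / p * (2 * Real.exp 2 * Real.log p / Real.log S) := by
            have : 0 ≤ Real.log (p : ℝ) := Real.log_natCast_nonneg p
            positivity
          linarith
      calc T p = E p + _ := hsplit
        _ ≤ E p + u p := by linarith
        _ ≤ E p * (1 + u p) := by nlinarith [hu0 p]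
        _ ≤ E p * Real.exp (u p) := mul_le_mul_of_nonneg_left (by linarith [Real.add_one_le_exp (u p)]) (by linarith)
        _ = Real.exp (u p) * E p := mul_comm _ _
  -- (2) the product of the factors
  have hT0 : ∀ p ∈ Nat.primesBelow S, 0 ≤ T p := fun p _ => Finset.sum_nonneg fun ν _ =>
    mul_nonneg (hb0 _) (Real.rpow_nonneg (Nat.cast_nonneg _) _)
  have hprod : ∏ p ∈ Nat.primesBelow S, T p ≤ ∏ p ∈ Nat.primesBelow S, (c p * E p) :=
    Finset.prod_le_prod hT0 hT_le
  rw [Finset.prod_mul_distrib] at hprod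
  refine hprod.trans (mul_le_mul_of_nonneg_right ?_ (Finset.prod_nonneg fun p hp => ?_))
  swap
  · exact zero_le_one.trans (one_le_localSum hf hy (hmem p hp).1)
  -- `∏ c p ≤ exp B`
  have hc_split : ∏ p ∈ Nat.primesBelow S, c p =
      (∏ p ∈ (Nat.primesBelow S).filter (fun p => p ≤ P₀), Real.exp (4 * k)) *
        ∏ p ∈ (Nat.primesBelow S).filter (fun p => ¬ p ≤ P₀), Real.exp (u p) := by
    rw [← Finset.prod_filter_mul_prod_filter_not (Nat.primesBelow S) (fun p => p ≤ P₀)]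
    congr 1
    · exact Finset.prod_congr rfl fun p hp => by rw [hcdef]; dsimp only; rw [if_pos (Finset.mem_filter.1 hp).2]
    · exact Finset.prod_congr rfl fun p hp => by rw [hcdef]; dsimp only; rw [if_neg (Finset.mem_filter.1 hp).2]
  rw [hc_split, Finset.prod_const, ← Real.exp_sum, ← Real.exp_nat_mul, ← Real.exp_add, Real.exp_le_exp, hBdef]
  have hA : (#((Nat.primesBelow S).filter fun p => p ≤ P₀) : ℝ) * (4 * k) ≤ 4 * k * (P₀ + 1) := by
    have : #((Nat.primesBelow S).filter fun p => p ≤ P₀) ≤ P₀ + 1 := by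
      calc #((Nat.primesBelow S).filter fun p => p ≤ P₀) ≤ #(range (P₀ + 1)) :=
            Finset.card_le_card fun p hp => by
              simp only [Finset.mem_filter] at hp
              exact Finset.mem_range.2 (by omega)
        _ = P₀ + 1 := Finset.card_range _
    have : (#((Nat.primesBelow S).filter fun p => p ≤ P₀) : ℝ) ≤ P₀ + 1 := by exact_mod_cast this
    nlinarith
  have hB : ∑ p ∈ (Nat.primesBelow S).filter (fun p => ¬ p ≤ P₀), u p ≤
      2 * Real.exp 2 * (y - 1) * (k + |L| / Real.log 2) + 2 * k * C' * Real.exp (4 * k) := by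
    calc ∑ p ∈ (Nat.primesBelow S).filter (fun p => ¬ p ≤ P₀), u p ≤ ∑ p ∈ Nat.primesBelow S, u p :=
          Finset.sum_le_sum_of_subset_of_nonneg (Finset.filter_subset _ _) fun p _ _ => hu0 p
      _ = (2 * Real.exp 2 * (y - 1) / Real.log S) *
            ∑ p ∈ Nat.primesBelow S, (∑ i, (polyRootCountMod ![f i] p : ℝ)) * Real.log p / p +
          2 * k * C' * Real.exp (4 * k) * ∑ p ∈ Nat.primesBelow S, 1 / (p : ℝ) ^ 2 := by
          have hu : ∀ p : ℕ, u p = (2 * Real.exp 2 * (y - 1) / Real.log S) *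
              ((∑ i, (polyRootCountMod ![f i] p : ℝ)) * Real.log p / p) +
              2 * k * C' * Real.exp (4 * k) * (1 / (p : ℝ) ^ 2) := fun p => by
            simp only [hudef]; ring
          rw [Finset.sum_congr rfl fun p _ => hu p, Finset.sum_add_distrib, ← Finset.mul_sum, ← Finset.mul_sum]
      _ ≤ (2 * Real.exp 2 * (y - 1) / Real.log S) * (k * Real.log S + |L|) +
          2 * k * C' * Real.exp (4 * k) * 1 := by
          gcongr
          · -- Landau–Mertens at `Q = S − 1` (`primesBelow S = primesLE (S − 1)`)
            rcases Nat.lt_or_ge S 3 with hS3 | hS3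
            · -- `S = 2`: no primes below
              interval_cases S
              · simp [Nat.primesBelow]
                positivity
            · have hQ : Nat.primesBelow S = Nat.primesLE (S - 1) := by
                rw [Nat.primesLE, Nat.sub_add_cancel (by omega)]
              rw [hQ]
              refine (hL (S - 1) (by omega)).trans ?_
              have h1 : Real.log ((S - 1 : ℕ) : ℝ) ≤ Real.log S := by
                refine Real.log_le_log (by exact_mod_cast (show 0 < S - 1 by omega)) ?_
                exact_mod_cast Nat.sub_le S 1
              have hk0 : (0 : ℝ) ≤ k := Nat.cast_nonneg _
              nlinarith [le_abs_self L]
          · exact Nair.sum_primes_inv_sq_le_one fun p hp => (hmem p hp).1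
      _ = 2 * Real.exp 2 * (y - 1) * (k + |L| / Real.log S) + 2 * k * C' * Real.exp (4 * k) := by
          field_simp
      _ ≤ 2 * Real.exp 2 * (y - 1) * (k + |L| / Real.log 2) + 2 * k * C' * Real.exp (4 * k) := by
          gcongr
  linarith

/-! ### Registered closed form -/

/-- **twistedLocalProduct_bound** (registered closed form, `--supports stmt-Parity-11292`): for every Bateman–Horn
system `f` and real `y ≥ 1` there is `B` with
`∏_{p < S} Σ_{ν ≤ 2k} b(p^ν) (p^ν)^{2/log S} ≤ e^B ∏_{p < S} Σ_{ν ≤ 2k} b(p^ν)` for all `S ≥ 2`. [folklore] -/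
theorem twistedLocalProduct_bound : ∀ (k : ℕ) (f : Fin k → ℤ[X]), IsBatemanHornSystem f → ∀ y : ℝ, 1 ≤ y → ∃ B : ℝ, ∀ S : ℕ, 2 ≤ S → ∏ p ∈ Nat.primesBelow S, ∑ ν ∈ Finset.range (2 * k + 1), bCoeff f y (p ^ ν) * ((p ^ ν : ℕ) : ℝ) ^ (2 / Real.log S) ≤ Real.exp B * ∏ p ∈ Nat.primesBelow S, ∑ ν ∈ Finset.range (2 * k + 1), bCoeff f y (p ^ ν) :=
  fun _k _f hf _y hy => twistedLocalProduct_le hf hy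

end

end Summit.Parity.BatemanHorn.Cruxes.SystemLSDRealSegment.BetaThinnedRootKernel
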